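import Literature.NumberTheory.Sieve.SmoothSaddlePoint
import Mathlib.NumberTheory.Chebyshev
import Mathlib.Analysis.SpecialFunctions.Integrals.Basic
import Mathlib.Analysis.SpecialFunctions.Pow.Asymptotics
import HarnessLib

/-!
# Hildebrand–Tenenbaum's approximation of the saddle point: `(1 - α) log y = log(u log(u+1)) + O(1)`

Topic `NumberTheory/Sieve` (smooth numbers); PROOF companion of `SmoothSaddlePoint.lean` (the saddle
point `saddlePoint x y = α(x, y)`, the unique positive root of `saddleSum α y = Σ_{p ≤ y} log p/(p^α - 1)
= log x`, Hildebrand–Tenenbaum's `φ₁(α, y) + log x = 0`). Everything here is PROVED (no definition, no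
named fact); only Chebyshev's bounds for `θ` (Mathlib) and Abel summation are used.

Hildebrand–Tenenbaum [HildebrandTenenbaum1986, Lemma 2 (3.5) and Lemma 1; Thm 2 (2.4)] show
`(1 - α(x, y)) log y = ξ(u) + O(1/u + …)` for `y > log x`, `ξ(u) = log(u log u) + O(log log u/log u)`,
and Lemma 3 (3.7): `(y^{1-α} - 1)/((1-α) log y) ≍ u`, `u = log x/log y`; Harper quotes this as
"(2.1): `α(x, y) = 1 - log(u log(u+1))/log y + O(1/log y)` when `log x < y ≤ x`" [Harper2016, §2.1]
and uses it as "`y^{1-α} = O(u log(u+1))`" (proof of Smooth Numbers Result 3; §4) and through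
"`Σ_j 2^{j(α-1)} ≪ log y/log(u+1)`" (ibid.). This file proves the `O(1)`-form in the range
`(log x)^3 ≤ y ≤ x`, `x ≥ x₀` (which contains Harper's `logᴷ x ≤ y ≤ x`, `K ≥ 3`):

* `rpow_one_sub_saddlePoint_le` — `y^{1-α(x,y)} ≤ C · u log(u+1)`;
* `le_rpow_one_sub_saddlePoint` — `y^{1-α(x,y)} ≥ c · u log(u+1)` (`c > 0`);
* `abs_one_sub_saddlePoint_mul_log_sub_log_le` — `|(1 - α) log y - log(u log(u+1))| ≤ C`;
* `log_add_one_sub_le_one_sub_saddlePoint_mul_log` — `(1 - α) log y ≥ log(u+1) - C`;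
* `saddlePoint_le_one_add_div_log` — `α(x, y) ≤ 1 + 4/log y` for `e^{107} ≤ y ≤ x`.

## The argument (partial summation at two test points)

With `T(σ, y) = Σ_{p ≤ y} log p · p^{-σ} = θ(y) y^{-σ} + σ ∫₂^y θ(t) t^{-σ-1} dt`
(`sum_primesLE_log_mul_rpow_eq`) and Chebyshev's `(log 2/2) t - c₁ ≤ θ(t) ≤ log 4 · t`
(`exists_theta_ge_linear`, Mathlib's `theta_le_log4_mul_x`, `theta_ge'`):
`(log 2/2) σ ∫₂^y t^{-σ} - c₁ ≤ T(σ, y) ≤ log 4 · (y^{1-σ} + σ ∫₂^y t^{-σ})`, and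
`T ≤ -φ₁ ≤ T + 30` for `σ ≥ 3/5` (`saddleSum_le_sum_primesLE_log_mul_rpow_add`). Since `-φ₁(·, y)` is
decreasing, `α ≥ σ₁` follows from `-φ₁(σ₁, y) ≥ log x` at `σ₁ = 1 - log(C u log(u+1))/log y`, and
`α ≤ σ₂` from `-φ₁(σ₂, y) ≤ log x` at `σ₂ = 1 - log(u log(u+1)/8)/log y` (`u ≥ e^{10}`; for bounded
`u` the bound `α ≤ 1 + 4/log y` suffices), using `∫₂^y t^{-σ} dt = (y^{1-σ} - 2^{1-σ})/(1-σ)`.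

NOT here: the printed range `log x < y ≤ x` (near `y = log x` the term `π(y)/α` of `-φ₁` dominates),
the sharper errors `O(1/u)`, `(2.4)`–`(2.5)`, `φ₂`.

## References

* [HildebrandTenenbaum1986] A. Hildebrand, G. Tenenbaum, *On integers free of large prime factors*,
  Trans. AMS 296 (1986) 265–290, §3: Lemma 1, Lemma 2 (3.3)–(3.5), Lemma 3 (3.7); Thm 2 (2.4)
  (held: `paper:doi-10-1090-s0002-9947-1986-0837811-1`, pp. 268, 272–273).
* [Harper2016] A. J. Harper, Compositio Math. 152 (2016) 1121–1158, §2.1 (2.1) and the proof of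
  Smooth Numbers Result 3 (arXiv:1408.1662, pp. 9–10).
-/

noncomputable section

open Real Filter Finset MeasureTheory Chebyshev

namespace Literature.NumberTheory.Sieve

variable {σ : ℝ} {y : ℕ}

/-! ### Chebyshev's bounds in linear form -/

/-- **Chebyshev from below, linear form**: there is `c₁ ≥ 0` with `θ(t) ≥ (log 2 / 2) t - c₁` for all
`t ≥ 0` (Mathlib's `Chebyshev.theta_ge'`, `θ(t) ≥ (t-1) log 2 - log(t+2) - 2√t log t`, and
`log t = o(√t)`). [folklore] -/
theorem exists_theta_ge_linear :
    ∃ c₁ : ℝ, 0 ≤ c₁ ∧ ∀ t : ℝ, 0 ≤ t → Real.log 2 / 2 * t - c₁ ≤ θ t := by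
  have hl2 : 0 < Real.log 2 := Real.log_pos one_lt_two
  have h := (isLittleO_log_rpow_atTop (by norm_num : (0 : ℝ) < 1 / 2)).bound
    (show 0 < Real.log 2 / 12 by positivity)
  obtain ⟨X₁, hX₁⟩ := Filter.eventually_atTop.1 h
  set X₀ : ℝ := max X₁ 8 with hX₀
  have hX₀8 : 8 ≤ X₀ := le_max_right _ _
  refine ⟨Real.log 2 / 2 * X₀, by positivity, fun t ht => ?_⟩
  by_cases htX : t < X₀
  · have h0 := theta_nonneg t
    have : Real.log 2 / 2 * t ≤ Real.log 2 / 2 * X₀ :=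
      mul_le_mul_of_nonneg_left htX.le (by positivity)
    linarith
  · push Not at htX
    have ht8 : 8 ≤ t := le_trans hX₀8 htX
    have ht1 : 1 ≤ t := by linarith
    have hlog := hX₁ t (le_trans (le_max_left _ _) htX)
    have hlogt0 : 0 ≤ Real.log t := Real.log_nonneg ht1
    have hsq : t ^ (1 / 2 : ℝ) = √t := by rw [Real.sqrt_eq_rpow]
    rw [Real.norm_of_nonneg hlogt0, Real.norm_of_nonneg (by positivity), hsq] at hlog
    have hsqrt1 : 1 ≤ √t := by
      rw [show (1 : ℝ) = √1 from Real.sqrt_one.symm]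
      exact Real.sqrt_le_sqrt ht1
    have hst : √t * √t = t := Real.mul_self_sqrt ht
    -- `log(t+2) ≤ log 2 + log t`
    have hlog2t : Real.log (t + 2) ≤ Real.log 2 + Real.log t := by
      rw [← Real.log_mul (by norm_num) (by linarith)]
      exact Real.log_le_log (by linarith) (by linarith)
    -- `log t ≤ √t log t ≤ (log 2/12) t`
    have h1 : Real.log t ≤ √t * Real.log t := by nlinarith
    have h2 : √t * Real.log t ≤ Real.log 2 / 12 * t := by
      have := mul_le_mul_of_nonneg_left hlog (Real.sqrt_nonneg t)
      nlinarith [hst]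
    have hθ := theta_ge' ht1
    have h8 : Real.log 2 * 8 ≤ Real.log 2 * t := mul_le_mul_of_nonneg_left ht8 hl2.le
    have hc : 0 ≤ Real.log 2 / 2 * X₀ := by positivity
    nlinarith

/-- **Chebyshev from above**: `θ(t) ≤ log 4 · t` (`t ≥ 0`), Mathlib's `theta_le_log4_mul_x`. [folklore] -/
theorem theta_le_linear {t : ℝ} (ht : 0 ≤ t) : θ t ≤ Real.log 4 * t :=
  theta_le_log4_mul_x ht

/-! ### The prime sum `T(σ, y) = Σ_{p ≤ y} log p · p^{-σ}` by partial summation -/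

/-- **Abel summation**: `Σ_{p ≤ y} log p · p^{-σ} = θ(y) y^{-σ} + σ ∫₂^y θ(t) t^{-σ-1} dt` (`y ≥ 2`).
[folklore] -/
theorem sum_primesLE_log_mul_rpow_eq (σ : ℝ) (hy : 2 ≤ y) :
    ∑ p ∈ Nat.primesLE y, Real.log p * (p : ℝ) ^ (-σ) =
      θ y * (y : ℝ) ^ (-σ) + σ * ∫ t in (2 : ℝ)..y, θ t * t ^ (-σ - 1) := by
  set c : ℕ → ℝ := fun n => if n.Prime then Real.log n else 0 with hc
  have hc0 : c 0 = 0 := by simp [hc, Nat.not_prime_zero]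
  have hc1 : c 1 = 0 := by simp [hc, Nat.not_prime_one]
  have hy2 : (2 : ℝ) ≤ (y : ℝ) := by exact_mod_cast hy
  -- the partial sums of `c` are `θ`
  have hθ : ∀ t : ℝ, ∑ k ∈ Icc 0 ⌊t⌋₊, c k = θ t := by
    intro t
    rw [theta_eq_sum_Icc, Finset.sum_filter]
  -- differentiability and the derivative of `t ↦ t^{-σ}` on `[2, y]`
  have hderiv : ∀ t : ℝ, 0 < t → deriv (fun t : ℝ => t ^ (-σ)) t = -σ * t ^ (-σ - 1) := by
    intro t ht
    rw [Real.deriv_rpow_const]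
  have hdiff : ∀ t ∈ Set.Icc (2 : ℝ) y, DifferentiableAt ℝ (fun t : ℝ => t ^ (-σ)) t := by
    intro t ht
    exact (Real.hasDerivAt_rpow_const (Or.inl (by linarith [ht.1] : t ≠ 0))).differentiableAt
  have hint : IntegrableOn (deriv fun t : ℝ => t ^ (-σ)) (Set.Icc (2 : ℝ) y) := by
    have hcont : ContinuousOn (fun t : ℝ => -σ * t ^ (-σ - 1)) (Set.Icc (2 : ℝ) y) := by
      refine ContinuousOn.mul continuousOn_const ?_
      exact ContinuousOn.rpow_const continuousOn_id fun t ht => Or.inl (by linarith [ht.1] : t ≠ 0)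
    refine (hcont.integrableOn_Icc).congr_fun (fun t ht => (hderiv t (by linarith [ht.1])).symm)
      measurableSet_Icc
  have habel := sum_mul_eq_sub_integral_mul₁ c hc0 hc1 (y : ℝ) hdiff hint
  rw [Nat.floor_natCast] at habel
  have hθy : ∑ k ∈ Icc 0 y, c k = θ y := by simpa only [Nat.floor_natCast] using hθ y
  -- left-hand side
  have hlhs : ∑ k ∈ Icc 0 y, (k : ℝ) ^ (-σ) * c k =
      ∑ p ∈ Nat.primesLE y, Real.log p * (p : ℝ) ^ (-σ) := by
    rw [Nat.primesLE_eq_filter_Icc_zero, Finset.sum_filter]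
    refine Finset.sum_congr rfl fun k _ => ?_
    by_cases hk : k.Prime
    · simp [hc, hk, mul_comm]
    · simp [hc, hk]
  rw [hlhs, hθy] at habel
  rw [habel]
  -- the integral
  have hIoc : ∫ t in Set.Ioc (2 : ℝ) y, deriv (fun t : ℝ => t ^ (-σ)) t * ∑ k ∈ Icc 0 ⌊t⌋₊, c k =
      ∫ t in (2 : ℝ)..y, -σ * (θ t * t ^ (-σ - 1)) := by
    rw [intervalIntegral.integral_of_le hy2]
    refine setIntegral_congr_fun measurableSet_Ioc fun t ht => ?_
    rw [hθ t, hderiv t (by linarith [ht.1])]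
    ring
  rw [hIoc, intervalIntegral.integral_const_mul]
  ring

/-- `θ(t) t^{r}` is interval integrable on `[a, b] ⊆ (0, ∞)` (θ is monotone, the power continuous away
from `0`). [folklore] -/
theorem intervalIntegrable_theta_mul_rpow (r : ℝ) {a b : ℝ} (ha : 0 < a) (hb : 0 < b) :
    IntervalIntegrable (fun t : ℝ => θ t * t ^ r) volume a b := by
  refine (theta_mono.intervalIntegrable).mul_continuousOn ?_
  refine ContinuousOn.rpow_const continuousOn_id fun t ht => Or.inl ?_
  have : 0 < t := by
    rcases Set.mem_uIcc.1 ht with h | h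
    · exact lt_of_lt_of_le ha h.1
    · exact lt_of_lt_of_le hb h.1
  exact this.ne'

/-- **Upper bound by partial summation**: `Σ_{p ≤ y} log p · p^{-σ} ≤ log 4 · (y^{1-σ} + σ ∫₂^y t^{-σ} dt)`
for `σ ≥ 0`, `y ≥ 2` (`θ(t) ≤ log 4 · t`). [folklore] -/
theorem sum_primesLE_log_mul_rpow_le (hσ : 0 ≤ σ) (hy : 2 ≤ y) :
    ∑ p ∈ Nat.primesLE y, Real.log p * (p : ℝ) ^ (-σ) ≤
      Real.log 4 * ((y : ℝ) ^ (1 - σ) + σ * ∫ t in (2 : ℝ)..y, t ^ (-σ)) := by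
  have hy2 : (2 : ℝ) ≤ (y : ℝ) := by exact_mod_cast hy
  have hy0 : (0 : ℝ) < (y : ℝ) := by linarith
  have hl4 : 0 ≤ Real.log 4 := Real.log_nonneg (by norm_num)
  rw [sum_primesLE_log_mul_rpow_eq σ hy]
  -- boundary term
  have h1 : θ y * (y : ℝ) ^ (-σ) ≤ Real.log 4 * (y : ℝ) ^ (1 - σ) := by
    calc θ y * (y : ℝ) ^ (-σ) ≤ Real.log 4 * y * (y : ℝ) ^ (-σ) :=
          mul_le_mul_of_nonneg_right (theta_le_linear hy0.le) (Real.rpow_nonneg hy0.le _)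
      _ = Real.log 4 * (y : ℝ) ^ (1 - σ) := by
          have h := Real.rpow_add hy0 1 (-σ)
          rw [Real.rpow_one, show (1 : ℝ) + -σ = 1 - σ by ring] at h
          rw [mul_assoc, h]
  -- integral term
  have h2 : ∫ t in (2 : ℝ)..y, θ t * t ^ (-σ - 1) ≤ ∫ t in (2 : ℝ)..y, Real.log 4 * t ^ (-σ) := by
    refine intervalIntegral.integral_mono_on hy2
      (intervalIntegrable_theta_mul_rpow _ two_pos hy0) ?_ fun t ht => ?_
    · exact (intervalIntegral.intervalIntegrable_rpow (Or.inr fun h => by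
        rcases Set.mem_uIcc.1 h with h | h <;> linarith [h.1])).const_mul _
    · have ht0 : 0 < t := by linarith [ht.1]
      calc θ t * t ^ (-σ - 1) ≤ Real.log 4 * t * t ^ (-σ - 1) :=
            mul_le_mul_of_nonneg_right (theta_le_linear ht0.le) (Real.rpow_nonneg ht0.le _)
        _ = Real.log 4 * t ^ (-σ) := by
            have h := Real.rpow_add ht0 1 (-σ - 1)
            rw [Real.rpow_one, show (1 : ℝ) + (-σ - 1) = -σ by ring] at h
            rw [mul_assoc, h]
  rw [intervalIntegral.integral_const_mul] at h2
  have h3 : σ * ∫ t in (2 : ℝ)..y, θ t * t ^ (-σ - 1) ≤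
      σ * (Real.log 4 * ∫ t in (2 : ℝ)..y, t ^ (-σ)) :=
    mul_le_mul_of_nonneg_left h2 hσ
  calc θ y * (y : ℝ) ^ (-σ) + σ * ∫ t in (2 : ℝ)..y, θ t * t ^ (-σ - 1)
      ≤ Real.log 4 * (y : ℝ) ^ (1 - σ) + σ * (Real.log 4 * ∫ t in (2 : ℝ)..y, t ^ (-σ)) :=
        add_le_add h1 h3
    _ = Real.log 4 * ((y : ℝ) ^ (1 - σ) + σ * ∫ t in (2 : ℝ)..y, t ^ (-σ)) := by ring

/-- **Lower bound by partial summation**: with `c₁` from `exists_theta_ge_linear`,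
`Σ_{p ≤ y} log p · p^{-σ} ≥ (log 2/2) σ ∫₂^y t^{-σ} dt - c₁` for `σ > 0`, `y ≥ 2`. [folklore] -/
theorem exists_sum_primesLE_log_mul_rpow_ge :
    ∃ c₁ : ℝ, 0 ≤ c₁ ∧ ∀ (σ : ℝ) (y : ℕ), 0 < σ → 2 ≤ y →
      Real.log 2 / 2 * σ * (∫ t in (2 : ℝ)..y, t ^ (-σ)) - c₁ ≤
        ∑ p ∈ Nat.primesLE y, Real.log p * (p : ℝ) ^ (-σ) := by
  obtain ⟨c₁, hc₁, hθ⟩ := exists_theta_ge_linear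
  refine ⟨c₁, hc₁, fun σ y hσ hy => ?_⟩
  have hy2 : (2 : ℝ) ≤ (y : ℝ) := by exact_mod_cast hy
  have hy0 : (0 : ℝ) < (y : ℝ) := by linarith
  set c₀ : ℝ := Real.log 2 / 2 with hc₀
  have hc₀0 : 0 < c₀ := by rw [hc₀]; exact div_pos (Real.log_pos one_lt_two) two_pos
  rw [sum_primesLE_log_mul_rpow_eq σ hy]
  -- drop the (nonnegative) boundary term
  have h1 : 0 ≤ θ y * (y : ℝ) ^ (-σ) := mul_nonneg (theta_nonneg _) (Real.rpow_nonneg hy0.le _)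
  -- lower bound for the integral
  have hint_rpow : ∀ r : ℝ, IntervalIntegrable (fun t : ℝ => t ^ r) volume (2 : ℝ) y := fun r =>
    intervalIntegral.intervalIntegrable_rpow (Or.inr fun h => by
      rcases Set.mem_uIcc.1 h with h | h <;> linarith [h.1])
  have h2 : ∫ t in (2 : ℝ)..y, (c₀ * t ^ (-σ) - c₁ * t ^ (-σ - 1)) ≤
      ∫ t in (2 : ℝ)..y, θ t * t ^ (-σ - 1) := by
    refine intervalIntegral.integral_mono_on hy2 (((hint_rpow _).const_mul _).sub
      ((hint_rpow _).const_mul _)) (intervalIntegrable_theta_mul_rpow _ two_pos hy0) fun t ht => ?_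
    have ht0 : 0 < t := by linarith [ht.1]
    have hpow : t ^ (-σ) = t * t ^ (-σ - 1) := by
      have h := Real.rpow_add ht0 1 (-σ - 1)
      rw [Real.rpow_one, show (1 : ℝ) + (-σ - 1) = -σ by ring] at h
      exact h
    calc c₀ * t ^ (-σ) - c₁ * t ^ (-σ - 1) = (c₀ * t - c₁) * t ^ (-σ - 1) := by rw [hpow]; ring
      _ ≤ θ t * t ^ (-σ - 1) :=
          mul_le_mul_of_nonneg_right (hθ t ht0.le) (Real.rpow_nonneg ht0.le _)
  rw [intervalIntegral.integral_sub ((hint_rpow _).const_mul _) ((hint_rpow _).const_mul _),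
    intervalIntegral.integral_const_mul, intervalIntegral.integral_const_mul] at h2
  -- `σ ∫₂^y t^{-σ-1} = 2^{-σ} - y^{-σ} ≤ 1`
  have h3 : σ * ∫ t in (2 : ℝ)..y, t ^ (-σ - 1) ≤ 1 := by
    rw [integral_rpow (Or.inr ⟨by linarith, fun h => by
      rcases Set.mem_uIcc.1 h with h | h <;> linarith [h.1]⟩)]
    rw [show (-σ - 1 + 1) = -σ by ring]
    have h2σ : (2 : ℝ) ^ (-σ) ≤ 1 :=
      Real.rpow_le_one_of_one_le_of_nonpos (by norm_num) (by linarith)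
    have hyσ : 0 ≤ (y : ℝ) ^ (-σ) := Real.rpow_nonneg hy0.le _
    have : σ * (((y : ℝ) ^ (-σ) - (2 : ℝ) ^ (-σ)) / -σ) = (2 : ℝ) ^ (-σ) - (y : ℝ) ^ (-σ) := by
      field_simp
      ring
    rw [this]
    linarith
  have h4 : σ * ∫ t in (2 : ℝ)..y, θ t * t ^ (-σ - 1) ≥
      σ * (c₀ * ∫ t in (2 : ℝ)..y, t ^ (-σ)) - c₁ * (σ * ∫ t in (2 : ℝ)..y, t ^ (-σ - 1)) := by
    have := mul_le_mul_of_nonneg_left h2 hσ.le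
    linarith
  have h5 : c₁ * (σ * ∫ t in (2 : ℝ)..y, t ^ (-σ - 1)) ≤ c₁ := by
    have := mul_le_mul_of_nonneg_left h3 hc₁
    linarith
  linarith


/-! ### The integral `∫₂^y t^{-σ} dt` -/

/-- `∫₂^y t^{-σ} dt = (y^{1-σ} - 2^{1-σ})/(1 - σ)` for `σ ≠ 1`. [folklore] -/
theorem integral_rpow_neg_eq (hσ : σ ≠ 1) (hy : 2 ≤ y) :
    ∫ t in (2 : ℝ)..y, t ^ (-σ) = ((y : ℝ) ^ (1 - σ) - (2 : ℝ) ^ (1 - σ)) / (1 - σ) := by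
  have hy2 : (2 : ℝ) ≤ (y : ℝ) := by exact_mod_cast hy
  rw [integral_rpow (Or.inr ⟨fun h => hσ (by linarith), fun h => by
    rcases Set.mem_uIcc.1 h with h | h <;> linarith [h.1]⟩)]
  rw [show (-σ + 1) = 1 - σ by ring]

/-- `∫₂^y t^{-σ} dt ≥ 0` (`y ≥ 2`). [folklore] -/
theorem integral_rpow_neg_nonneg (σ : ℝ) (hy : 2 ≤ y) : 0 ≤ ∫ t in (2 : ℝ)..y, t ^ (-σ) :=
  intervalIntegral.integral_nonneg (by exact_mod_cast hy) fun t ht =>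
    Real.rpow_nonneg (by linarith [ht.1]) _

/-- `∫₂^y t^{-σ} dt ≤ y^{1-σ}/(1-σ)` for `σ < 1`. [folklore] -/
theorem integral_rpow_neg_le_of_lt_one (hσ : σ < 1) (hy : 2 ≤ y) :
    ∫ t in (2 : ℝ)..y, t ^ (-σ) ≤ (y : ℝ) ^ (1 - σ) / (1 - σ) := by
  rw [integral_rpow_neg_eq hσ.ne hy]
  have : 0 ≤ (2 : ℝ) ^ (1 - σ) := by positivity
  exact div_le_div_of_nonneg_right (by linarith) (by linarith)

/-- `∫₂^y t^{-σ} dt ≥ (y^{1-σ} - 2)/(1-σ)` for `0 ≤ σ < 1`. [folklore] -/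
theorem sub_two_div_le_integral_rpow_neg (hσ0 : 0 ≤ σ) (hσ : σ < 1) (hy : 2 ≤ y) :
    ((y : ℝ) ^ (1 - σ) - 2) / (1 - σ) ≤ ∫ t in (2 : ℝ)..y, t ^ (-σ) := by
  rw [integral_rpow_neg_eq hσ.ne hy]
  have : (2 : ℝ) ^ (1 - σ) ≤ 2 := by
    calc (2 : ℝ) ^ (1 - σ) ≤ (2 : ℝ) ^ (1 : ℝ) :=
          Real.rpow_le_rpow_of_exponent_le one_le_two (by linarith)
      _ = 2 := Real.rpow_one 2
  exact div_le_div_of_nonneg_right (by linarith) (by linarith)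

/-- `∫₂^y t^{-σ} dt ≤ 1/(σ - 1)` for `σ > 1`. [folklore] -/
theorem integral_rpow_neg_le_of_one_lt (hσ : 1 < σ) (hy : 2 ≤ y) :
    ∫ t in (2 : ℝ)..y, t ^ (-σ) ≤ 1 / (σ - 1) := by
  rw [integral_rpow_neg_eq hσ.ne' hy]
  have h2 : (2 : ℝ) ^ (1 - σ) ≤ 1 :=
    Real.rpow_le_one_of_one_le_of_nonpos (by norm_num) (by linarith)
  have hy0 : 0 ≤ (y : ℝ) ^ (1 - σ) := by positivity
  have hne : (1 : ℝ) - σ ≠ 0 := (by linarith : (1 : ℝ) - σ < 0).ne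
  have hne' : σ - 1 ≠ 0 := (by linarith : (0 : ℝ) < σ - 1).ne'
  have heq : ((y : ℝ) ^ (1 - σ) - (2 : ℝ) ^ (1 - σ)) / (1 - σ) =
      ((2 : ℝ) ^ (1 - σ) - (y : ℝ) ^ (1 - σ)) / (σ - 1) := by
    field_simp
    ring
  rw [heq]
  exact div_le_div_of_nonneg_right (by linarith) (by linarith)

/-! ### `-φ₁(σ, y)` versus `T(σ, y)` -/

/-- `Σ_{p ≤ y} log p · p^{-σ} ≤ Σ_{p ≤ y} log p/(p^σ - 1)` (`σ > 0`; `p^{-σ} ≤ 1/(p^σ - 1)`). [folklore] -/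
theorem sum_primesLE_log_mul_rpow_le_saddleSum (hσ : 0 < σ) (y : ℕ) :
    ∑ p ∈ Nat.primesLE y, Real.log p * (p : ℝ) ^ (-σ) ≤ saddleSum σ y := by
  rw [saddleSum]
  refine Finset.sum_le_sum fun p hp => ?_
  obtain ⟨-, hpp⟩ := Nat.mem_primesLE.1 hp
  have hp2 : (2 : ℝ) ≤ p := by exact_mod_cast hpp.two_le
  have hp0 : (0 : ℝ) < p := by linarith
  have hlog : 0 ≤ Real.log p := Real.log_nonneg (by linarith)
  have hpσ : 1 < (p : ℝ) ^ σ := Real.one_lt_rpow (by linarith) hσ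
  rw [Real.rpow_neg hp0.le, ← div_eq_mul_inv]
  exact div_le_div_of_nonneg_left hlog (by linarith) (by linarith)

/-- `2^{3/5} ≥ 3/2` (`(3/2)^5 = 7.59375 ≤ 8`). [folklore] -/
theorem three_halves_le_two_rpow : (3 / 2 : ℝ) ≤ (2 : ℝ) ^ (3 / 5 : ℝ) := by
  by_contra h
  push Not at h
  have h0 : 0 ≤ (2 : ℝ) ^ (3 / 5 : ℝ) := by positivity
  have h5 : ((2 : ℝ) ^ (3 / 5 : ℝ)) ^ 5 < (3 / 2 : ℝ) ^ 5 := pow_lt_pow_left₀ h h0 (by norm_num)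
  have heq : ((2 : ℝ) ^ (3 / 5 : ℝ)) ^ 5 = 8 := by
    rw [← Real.rpow_natCast, ← Real.rpow_mul (by norm_num : (0 : ℝ) ≤ 2),
      show (3 / 5 : ℝ) * ((5 : ℕ) : ℝ) = ((3 : ℕ) : ℝ) by norm_num, Real.rpow_natCast]
    norm_num
  rw [heq] at h5
  norm_num at h5

/-- `log 4 ≤ 1.3863` (`log 2 < 0.6931471808`). [folklore] -/
theorem log_four_le : Real.log 4 ≤ 1.3863 := by
  have h : Real.log 4 = 2 * Real.log 2 := by
    rw [show (4 : ℝ) = 2 ^ 2 by norm_num, Real.log_pow]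
    push_cast
    ring
  rw [h]
  have := Real.log_two_lt_d9
  linarith

/-- **`-φ₁(σ, y) = T(σ, y) + O(1)` for `σ ≥ 3/5`**: `Σ_{p ≤ y} log p/(p^σ - 1) ≤ Σ_{p ≤ y} log p · p^{-σ} + 30`
(`1/(p^σ - 1) - p^{-σ} = p^{-σ}/(p^σ - 1) ≤ 3 p^{-2σ}` as `p^σ ≥ 2^{3/5} ≥ 3/2`, and
`Σ_p log p · p^{-2σ} ≤ log 4 · (1 + 2σ/(2σ - 1)) ≤ 7 log 4` by partial summation). [folklore] -/
theorem saddleSum_le_sum_primesLE_log_mul_rpow_add (hσ : 3 / 5 ≤ σ) (hy : 2 ≤ y) :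
    saddleSum σ y ≤ ∑ p ∈ Nat.primesLE y, Real.log p * (p : ℝ) ^ (-σ) + 30 := by
  have hσ0 : 0 < σ := by linarith
  have hy1 : (1 : ℝ) ≤ (y : ℝ) := by exact_mod_cast (le_trans one_le_two hy)
  -- termwise bound
  have hterm : ∀ p ∈ Nat.primesLE y, Real.log p / ((p : ℝ) ^ σ - 1) ≤
      Real.log p * (p : ℝ) ^ (-σ) + 3 * (Real.log p * (p : ℝ) ^ (-(2 * σ))) := by
    intro p hp
    obtain ⟨-, hpp⟩ := Nat.mem_primesLE.1 hp
    have hp2 : (2 : ℝ) ≤ p := by exact_mod_cast hpp.two_le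
    have hp0 : (0 : ℝ) < p := by linarith
    have hlog : 0 ≤ Real.log p := Real.log_nonneg (by linarith)
    set P : ℝ := (p : ℝ) ^ σ with hP
    have hP32 : (3 / 2 : ℝ) ≤ P := by
      calc (3 / 2 : ℝ) ≤ (2 : ℝ) ^ (3 / 5 : ℝ) := three_halves_le_two_rpow
        _ ≤ (2 : ℝ) ^ σ := Real.rpow_le_rpow_of_exponent_le one_le_two hσ
        _ ≤ (p : ℝ) ^ σ := Real.rpow_le_rpow (by norm_num) hp2 hσ0.le
    have hP0 : 0 < P := by linarith
    have hinv : (p : ℝ) ^ (-σ) = P⁻¹ := by rw [hP, Real.rpow_neg hp0.le]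
    have hinv2 : (p : ℝ) ^ (-(2 * σ)) = P⁻¹ * P⁻¹ := by
      rw [Real.rpow_neg hp0.le, show (2 * σ) = σ + σ by ring, Real.rpow_add hp0, mul_inv]
    rw [hinv, hinv2]
    have hkey : 1 / (P - 1) ≤ P⁻¹ + 3 * (P⁻¹ * P⁻¹) := by
      rw [← sub_nonneg]
      have hP1 : P - 1 ≠ 0 := (by linarith : (0 : ℝ) < P - 1).ne'
      have : P⁻¹ + 3 * (P⁻¹ * P⁻¹) - 1 / (P - 1) = (2 * P - 3) / (P ^ 2 * (P - 1)) := by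
        field_simp
        ring
      rw [this]
      exact div_nonneg (by linarith) (mul_nonneg (sq_nonneg _) (by linarith))
    calc Real.log p / (P - 1) = Real.log p * (1 / (P - 1)) := by rw [mul_one_div]
      _ ≤ Real.log p * (P⁻¹ + 3 * (P⁻¹ * P⁻¹)) := mul_le_mul_of_nonneg_left hkey hlog
      _ = Real.log p * P⁻¹ + 3 * (Real.log p * (P⁻¹ * P⁻¹)) := by ring
  -- the sum `Σ_p log p · p^{-2σ} ≤ 7 log 4`
  have h2σ1 : 1 < 2 * σ := by linarith
  have hT2 : ∑ p ∈ Nat.primesLE y, Real.log p * (p : ℝ) ^ (-(2 * σ)) ≤ 10 := by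
    have h := sum_primesLE_log_mul_rpow_le (σ := 2 * σ) (y := y) (by linarith) hy
    have hI := integral_rpow_neg_le_of_one_lt (y := y) h2σ1 hy
    have hI0 := integral_rpow_neg_nonneg (2 * σ) hy
    have hypow : (y : ℝ) ^ (1 - 2 * σ) ≤ 1 :=
      Real.rpow_le_one_of_one_le_of_nonpos hy1 (by linarith)
    have hl4 := log_four_le
    have hl40 : 0 < Real.log 4 := Real.log_pos (by norm_num)
    -- `2σ ∫ ≤ 2σ/(2σ - 1) ≤ 6`
    have hfrac : 2 * σ * ∫ t in (2 : ℝ)..y, t ^ (-(2 * σ)) ≤ 6 := by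
      calc 2 * σ * ∫ t in (2 : ℝ)..y, t ^ (-(2 * σ)) ≤ 2 * σ * (1 / (2 * σ - 1)) :=
            mul_le_mul_of_nonneg_left hI (by linarith)
        _ ≤ 6 := by
            rw [mul_one_div, div_le_iff₀ (by linarith)]
            linarith
    calc ∑ p ∈ Nat.primesLE y, Real.log p * (p : ℝ) ^ (-(2 * σ))
        ≤ Real.log 4 * ((y : ℝ) ^ (1 - 2 * σ) + 2 * σ * ∫ t in (2 : ℝ)..y, t ^ (-(2 * σ))) := h
      _ ≤ Real.log 4 * 7 := mul_le_mul_of_nonneg_left (by linarith) hl40.le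
      _ ≤ 10 := by linarith
  calc saddleSum σ y = ∑ p ∈ Nat.primesLE y, Real.log p / ((p : ℝ) ^ σ - 1) := rfl
    _ ≤ ∑ p ∈ Nat.primesLE y,
          (Real.log p * (p : ℝ) ^ (-σ) + 3 * (Real.log p * (p : ℝ) ^ (-(2 * σ)))) :=
        Finset.sum_le_sum hterm
    _ = ∑ p ∈ Nat.primesLE y, Real.log p * (p : ℝ) ^ (-σ) +
          3 * ∑ p ∈ Nat.primesLE y, Real.log p * (p : ℝ) ^ (-(2 * σ)) := by
        rw [Finset.sum_add_distrib, ← Finset.mul_sum]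
    _ ≤ ∑ p ∈ Nat.primesLE y, Real.log p * (p : ℝ) ^ (-σ) + 3 * 10 := by linarith
    _ = ∑ p ∈ Nat.primesLE y, Real.log p * (p : ℝ) ^ (-σ) + 30 := by norm_num

/-! ### Auxiliary facts about the range `(log x)^3 ≤ y ≤ x` -/

/-- `log z ≤ κ z^ε` beyond a threshold (`κ, ε > 0`; `log z = o(z^ε)`). [folklore] -/
theorem exists_log_le_mul_rpow {κ ε : ℝ} (hκ : 0 < κ) (hε : 0 < ε) :
    ∃ Y : ℝ, 1 ≤ Y ∧ ∀ z : ℝ, Y ≤ z → Real.log z ≤ κ * z ^ ε := by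
  have h := (isLittleO_log_rpow_atTop hε).bound hκ
  obtain ⟨Y₁, hY₁⟩ := Filter.eventually_atTop.1 h
  refine ⟨max Y₁ 1, le_max_right _ _, fun z hz => ?_⟩
  have hz1 : 1 ≤ z := le_trans (le_max_right _ _) hz
  have := hY₁ z (le_trans (le_max_left _ _) hz)
  rwa [Real.norm_of_nonneg (Real.log_nonneg hz1),
    Real.norm_of_nonneg (Real.rpow_nonneg (by linarith) _)] at this

/-- `log 8 > 1` (`e < 8`). [folklore] -/
theorem one_lt_log_eight : 1 < Real.log 8 := by
  rw [Real.lt_log_iff_exp_lt (by norm_num)]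
  have := Real.exp_one_lt_d9
  linarith

/-- Bookkeeping in the range `(log x)^3 ≤ y ≤ x`, `y ≥ 8`: `x > 1`, `y ≥ 2`, `1 < log y ≤ log x`,
`u = log x/log y ≥ 1`, `log x ≤ y^{1/3}`, `u ≤ y^{1/3}` and `log(u + 1) ≤ log y`. [folklore] -/
theorem range_aux {x : ℝ} {y : ℕ} (hy8 : 8 ≤ y) (hlx : Real.log x ^ 3 ≤ y) (hyx : (y : ℝ) ≤ x) :
    1 < x ∧ 2 ≤ y ∧ 1 < Real.log y ∧ Real.log y ≤ Real.log x ∧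
      1 ≤ Real.log x / Real.log y ∧ Real.log x ≤ (y : ℝ) ^ (1 / 3 : ℝ) ∧
      Real.log x / Real.log y ≤ (y : ℝ) ^ (1 / 3 : ℝ) ∧
      Real.log (Real.log x / Real.log y + 1) ≤ Real.log y := by
  have hy8' : (8 : ℝ) ≤ (y : ℝ) := by exact_mod_cast hy8
  have hy0 : (0 : ℝ) < (y : ℝ) := by linarith
  have hx1 : 1 < x := by linarith
  have hlogy : 1 < Real.log y :=
    lt_of_lt_of_le one_lt_log_eight (Real.log_le_log (by norm_num) hy8')
  have hlogyx : Real.log y ≤ Real.log x := Real.log_le_log hy0 hyx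
  have hlogx0 : 0 ≤ Real.log x := by linarith
  have hu1 : 1 ≤ Real.log x / Real.log y := by rwa [one_le_div (by linarith)]
  -- `log x ≤ y^{1/3}`
  have hr : (y : ℝ) ^ (1 / 3 : ℝ) = ((y : ℝ) ^ ((3 : ℕ) : ℝ)⁻¹) := by norm_num
  have hlxy : Real.log x ≤ (y : ℝ) ^ (1 / 3 : ℝ) := by
    have h := Real.rpow_le_rpow (pow_nonneg hlogx0 3) hlx (by norm_num : (0 : ℝ) ≤ 1 / 3)
    rwa [show (1 / 3 : ℝ) = ((3 : ℕ) : ℝ)⁻¹ by norm_num,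
      Real.pow_rpow_inv_natCast hlogx0 (by norm_num), ← hr] at h
  have huy : Real.log x / Real.log y ≤ (y : ℝ) ^ (1 / 3 : ℝ) :=
    le_trans (div_le_self hlogx0 hlogy.le) hlxy
  -- `u + 1 ≤ y`: with `r = y^{1/3} ≥ 2`, `r + 1 ≤ r³ = y`
  set r : ℝ := (y : ℝ) ^ (1 / 3 : ℝ) with hrdef
  have hr2 : 2 ≤ r := by
    have h := Real.rpow_le_rpow (by norm_num : (0 : ℝ) ≤ 8) hy8' (by norm_num : (0 : ℝ) ≤ 1 / 3)
    rwa [show (8 : ℝ) = 2 ^ 3 by norm_num, show (1 / 3 : ℝ) = ((3 : ℕ) : ℝ)⁻¹ by norm_num,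
      Real.pow_rpow_inv_natCast (by norm_num : (0 : ℝ) ≤ 2) (by norm_num), ← hr] at h
  have hr3 : r ^ 3 = y := by
    rw [hrdef, ← Real.rpow_natCast, ← Real.rpow_mul hy0.le]
    norm_num
  have hu_le_y : Real.log x / Real.log y + 1 ≤ y := by
    have h4 : r ^ 3 - 4 * r = r * (r - 2) * (r + 2) := by ring
    have h5 : 0 ≤ r * (r - 2) * (r + 2) :=
      mul_nonneg (mul_nonneg (by linarith) (by linarith)) (by linarith)
    linarith [huy]
  have hlogu : Real.log (Real.log x / Real.log y + 1) ≤ Real.log y :=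
    Real.log_le_log (by linarith) hu_le_y
  exact ⟨hx1, le_trans (by norm_num) hy8, hlogy, hlogyx, hu1, hlxy, huy, hlogu⟩

variable {x : ℝ}

/-- `α(x, y) ≤ σ` as soon as `-φ₁(σ, y) ≤ log x` (`σ > 0`; strict monotonicity). [folklore] -/
theorem saddlePoint_le_of_saddleSum_le (hx : 1 < x) (hy : 2 ≤ y) (hσ : 0 < σ)
    (h : saddleSum σ y ≤ Real.log x) : saddlePoint x y ≤ σ := by
  by_contra hlt
  push Not at hlt
  have h2 : saddleSum (saddlePoint x y) y < saddleSum σ y :=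
    saddleSum_strictAntiOn hy hσ (saddlePoint_pos hx hy) hlt
  rw [saddleSum_saddlePoint hx hy] at h2
  linarith

/-- `σ ≤ α(x, y)` as soon as `log x ≤ -φ₁(σ, y)` (`σ > 0`). [folklore] -/
theorem le_saddlePoint_of_le_saddleSum (hx : 1 < x) (hy : 2 ≤ y) (hσ : 0 < σ)
    (h : Real.log x ≤ saddleSum σ y) : σ ≤ saddlePoint x y := by
  by_contra hlt
  push Not at hlt
  have := (saddlePoint_lt_iff hx hy hσ).1 hlt
  linarith

/-! ### The upper bound `y^{1-α} ≪ u log(u+1)` -/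

/-- **`y^{1 - α(x,y)} ≪ u log(u + 1)`** (`u = log x/log y`) in the range `(log x)^3 ≤ y ≤ x`, `x ≥ x₀`:
the half "`1 - α(x, y) ≤ (log(u log(u+1)) + O(1))/log y`" of Hildebrand–Tenenbaum's approximation
[HildebrandTenenbaum1986, Lemma 2 (3.5) with Lemma 1; Thm 2 (2.4)], in the form
"`y^{1-α} = O(u log(u+1))`" in which [Harper2016, §2.1 (2.1)] uses it (proof of Smooth Numbers
Result 3; §4). Proof: at `σ₁ = 1 - log(C u log(u+1))/log y` partial summation gives
`-φ₁(σ₁, y) ≥ Σ_{p ≤ y} log p · p^{-σ₁} ≥ (log 2/4)(y^{1-σ₁} - 2) log y/log(C u log(u+1)) - c₁ ≥ log x`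
for `C` large, whence `α ≥ σ₁`. (Printed range: `log x < y ≤ x`. TODO(general form).)
[cite: HildebrandTenenbaum1986, Lemma 2 (3.5) and Lemma 3 (3.7)] [cite: Harper2016, §2.1 (2.1)] -/
theorem rpow_one_sub_saddlePoint_le :
    ∃ C x₀ : ℝ, 0 < C ∧ ∀ (x : ℝ) (y : ℕ), x₀ ≤ x → Real.log x ^ 3 ≤ y → (y : ℝ) ≤ x →
      (y : ℝ) ^ (1 - saddlePoint x y) ≤
        C * (Real.log x / Real.log y * Real.log (Real.log x / Real.log y + 1)) := by
  obtain ⟨c₁, hc₁, hT⟩ := exists_sum_primesLE_log_mul_rpow_ge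
  set ℓ : ℝ := Real.log 2 with hℓ
  have hℓ0 : 0 < ℓ := Real.log_pos one_lt_two
  have hℓ1 : ℓ < 1 := by rw [hℓ]; have := Real.log_two_lt_d9; linarith
  have hℓ23 : 2 / 3 < ℓ := by rw [hℓ]; have := Real.log_two_gt_d9; linarith
  set M : ℝ := 40 * (1 + c₁) / ℓ + 4 / ℓ + 1 with hM
  have hM40 : 40 * (1 + c₁) / ℓ ≤ M := by
    have : 0 ≤ 4 / ℓ := by positivity
    linarith
  have hM4 : 4 / ℓ ≤ M := by
    have : 0 ≤ 40 * (1 + c₁) / ℓ := by positivity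
    linarith
  have hM1 : 1 ≤ M := by
    have : 0 ≤ 40 * (1 + c₁) / ℓ := by positivity
    have : 0 ≤ 4 / ℓ := by positivity
    linarith
  have hM0 : 0 < M := by linarith
  set C : ℝ := M ^ 2 with hC
  have hCM : M ≤ C := by rw [hC]; nlinarith
  have hC0 : 0 < C := by positivity
  obtain ⟨Y, hY1, hY⟩ :=
    exists_log_le_mul_rpow (κ := 1 / C) (ε := 1 / 6) (by positivity) (by norm_num)
  refine ⟨C, Real.exp (max Y 8), hC0, fun x y hx hlx hyx => ?_⟩
  -- the range
  have hlogx : max Y 8 ≤ Real.log x := by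
    have := Real.log_le_log (Real.exp_pos _) hx
    rwa [Real.log_exp] at this
  have hlogx8 : 8 ≤ Real.log x := le_trans (le_max_right _ _) hlogx
  have hlogx_le_y : Real.log x ≤ y := by
    have : Real.log x ≤ Real.log x ^ 3 := by
      calc Real.log x = Real.log x * 1 * 1 := by ring
        _ ≤ Real.log x * Real.log x * Real.log x := by gcongr <;> linarith
        _ = Real.log x ^ 3 := by ring
    linarith
  have hy8r : (8 : ℝ) ≤ y := by linarith
  have hy8 : 8 ≤ y := by exact_mod_cast hy8r
  have hyY : Y ≤ y := by linarith [le_max_left Y 8]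
  obtain ⟨hx1, hy2, hlogy1, hlogyx, hu1, hlxy, huy, hlogu⟩ := range_aux hy8 hlx hyx
  have hy0 : (0 : ℝ) < y := by linarith
  have hy1 : (1 : ℝ) ≤ y := by linarith
  have hlogy0 : 0 < Real.log y := by linarith
  set u : ℝ := Real.log x / Real.log y with hu
  have hulogy : u * Real.log y = Real.log x := by rw [hu]; field_simp
  have hu0 : 0 < u := by linarith
  have hlogu1 : ℓ ≤ Real.log (u + 1) := by
    rw [hℓ]; exact Real.log_le_log two_pos (by linarith)
  have hlogu0 : 0 < Real.log (u + 1) := by linarith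
  set E₀ : ℝ := u * Real.log (u + 1) with hE₀
  have hE₀ℓ : ℓ ≤ E₀ := by
    calc ℓ = 1 * ℓ := (one_mul ℓ).symm
      _ ≤ u * Real.log (u + 1) := mul_le_mul hu1 hlogu1 hℓ0.le hu0.le
  have hE₀0 : 0 < E₀ := by linarith
  have hCE4 : 4 ≤ C * E₀ := by
    calc (4 : ℝ) = 4 / ℓ * ℓ := by field_simp
      _ ≤ C * E₀ := mul_le_mul (le_trans hM4 hCM) hE₀ℓ hℓ0.le hC0.le
  set Λ : ℝ := Real.log (C * E₀) with hΛ
  have hΛ1 : 1 < Λ := by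
    calc (1 : ℝ) < Real.log 4 := by
          rw [Real.lt_log_iff_exp_lt (by norm_num)]; have := Real.exp_one_lt_d9; linarith
      _ ≤ Λ := Real.log_le_log (by norm_num) hCE4
  have hΛ0 : 0 < Λ := by linarith
  -- `C E₀ ≤ y^{1/2}`, so `Λ ≤ (log y)/2`
  have hE₀le : E₀ ≤ (y : ℝ) ^ (1 / 3 : ℝ) * Real.log y :=
    mul_le_mul huy hlogu (hlogu0.le) (Real.rpow_nonneg hy0.le _)
  have hCE : C * E₀ ≤ (y : ℝ) ^ (1 / 2 : ℝ) := by
    have h1 := hY y hyY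
    calc C * E₀ ≤ C * ((y : ℝ) ^ (1 / 3 : ℝ) * Real.log y) := mul_le_mul_of_nonneg_left hE₀le hC0.le
      _ ≤ C * ((y : ℝ) ^ (1 / 3 : ℝ) * (1 / C * (y : ℝ) ^ (1 / 6 : ℝ))) :=
          mul_le_mul_of_nonneg_left
            (mul_le_mul_of_nonneg_left h1 (Real.rpow_nonneg hy0.le _)) hC0.le
      _ = (y : ℝ) ^ (1 / 3 : ℝ) * (y : ℝ) ^ (1 / 6 : ℝ) := by field_simp
      _ = (y : ℝ) ^ (1 / 2 : ℝ) := by rw [← Real.rpow_add hy0]; norm_num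
  have hΛle : Λ ≤ Real.log y / 2 := by
    calc Λ ≤ Real.log ((y : ℝ) ^ (1 / 2 : ℝ)) := Real.log_le_log (by positivity) hCE
      _ = Real.log y / 2 := by rw [Real.log_rpow hy0]; ring
  -- the test point `σ₁`
  set σ₁ : ℝ := 1 - Λ / Real.log y with hσ₁
  have h1σ₁ : 1 - σ₁ = Λ / Real.log y := by rw [hσ₁]; ring
  have hΛdiv : Λ / Real.log y ≤ 1 / 2 := by
    rw [div_le_iff₀ hlogy0]; linarith
  have hΛdiv0 : 0 < Λ / Real.log y := div_pos hΛ0 hlogy0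
  have hσ₁half : 1 / 2 ≤ σ₁ := by linarith
  have hσ₁lt : σ₁ < 1 := by linarith
  have hσ₁0 : 0 < σ₁ := by linarith
  have hpow : (y : ℝ) ^ (1 - σ₁) = C * E₀ := by
    rw [h1σ₁, Real.rpow_def_of_pos hy0, show Real.log y * (Λ / Real.log y) = Λ by field_simp, hΛ,
      Real.exp_log (by positivity)]
  -- the integral at `σ₁`
  have hI : C * E₀ / 2 * (Real.log y / Λ) ≤ ∫ t in (2 : ℝ)..y, t ^ (-σ₁) := by
    have h := sub_two_div_le_integral_rpow_neg hσ₁0.le hσ₁lt hy2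
    rw [hpow, h1σ₁] at h
    calc C * E₀ / 2 * (Real.log y / Λ) ≤ (C * E₀ - 2) * (Real.log y / Λ) :=
          mul_le_mul_of_nonneg_right (by linarith) (by positivity)
      _ = (C * E₀ - 2) / (Λ / Real.log y) := by field_simp
      _ ≤ ∫ t in (2 : ℝ)..y, t ^ (-σ₁) := h
  -- `Λ ≤ 5 M log(u+1)`
  have hΛle' : Λ ≤ 5 * M * Real.log (u + 1) := by
    have hlogC : Real.log C ≤ 2 * M := by
      rw [hC, Real.log_pow]; push_cast
      have := Real.log_le_sub_one_of_pos hM0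
      linarith
    have hlogE : Real.log E₀ ≤ 2 * Real.log (u + 1) := by
      rw [hE₀, Real.log_mul hu0.ne' hlogu0.ne']
      have h1 : Real.log u ≤ Real.log (u + 1) := Real.log_le_log hu0 (by linarith)
      have h2 : Real.log (Real.log (u + 1)) ≤ Real.log (u + 1) := by
        have := Real.log_le_sub_one_of_pos hlogu0; linarith
      linarith
    have h2M : 2 * M ≤ 3 * M * Real.log (u + 1) := by
      -- `log(u+1) ≥ ℓ > 2/3`
      have h1 : 3 * M * ℓ ≤ 3 * M * Real.log (u + 1) :=
        mul_le_mul_of_nonneg_left hlogu1 (by positivity)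
      have h2 : 3 * M * (2 / 3) ≤ 3 * M * ℓ := mul_le_mul_of_nonneg_left hℓ23.le (by positivity)
      linarith
    calc Λ = Real.log C + Real.log E₀ := by rw [hΛ, Real.log_mul hC0.ne' hE₀0.ne']
      _ ≤ 2 * M + 2 * Real.log (u + 1) := add_le_add hlogC hlogE
      _ ≤ 3 * M * Real.log (u + 1) + 2 * M * Real.log (u + 1) := by
          have : 2 * Real.log (u + 1) ≤ 2 * M * Real.log (u + 1) :=
            mul_le_mul_of_nonneg_right (by linarith) hlogu0.le
          linarith
      _ = 5 * M * Real.log (u + 1) := by ring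
  -- `T(σ₁, y) ≥ (ℓ/4) I - c₁ ≥ (ℓ M/40) u log y - c₁ ≥ (1 + c₁) u log y - c₁ ≥ log x`
  have hTσ₁ := hT σ₁ y hσ₁0 hy2
  have hI0 := integral_rpow_neg_nonneg σ₁ hy2
  have hstep1 : ℓ / 4 * (C * E₀ / 2 * (Real.log y / Λ)) ≤
      Real.log 2 / 2 * σ₁ * ∫ t in (2 : ℝ)..y, t ^ (-σ₁) := by
    calc ℓ / 4 * (C * E₀ / 2 * (Real.log y / Λ)) ≤ ℓ / 4 * ∫ t in (2 : ℝ)..y, t ^ (-σ₁) :=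
          mul_le_mul_of_nonneg_left hI (by positivity)
      _ ≤ Real.log 2 / 2 * σ₁ * ∫ t in (2 : ℝ)..y, t ^ (-σ₁) := by
          rw [← hℓ]
          have h1 : ℓ / 2 * (1 / 2) ≤ ℓ / 2 * σ₁ :=
            mul_le_mul_of_nonneg_left hσ₁half (by positivity)
          have : ℓ / 4 ≤ ℓ / 2 * σ₁ := by linarith
          exact mul_le_mul_of_nonneg_right this hI0
  have hstep2 : ℓ * M / 40 * (u * Real.log y) ≤ ℓ / 4 * (C * E₀ / 2 * (Real.log y / Λ)) := by
    have h5M : 0 < 5 * M * Real.log (u + 1) := by positivity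
    have hfrac : Real.log y / (5 * M * Real.log (u + 1)) ≤ Real.log y / Λ :=
      div_le_div_of_nonneg_left hlogy0.le hΛ0 hΛle'
    calc ℓ * M / 40 * (u * Real.log y)
        = ℓ / 4 * (C * E₀ / 2 * (Real.log y / (5 * M * Real.log (u + 1)))) := by
          rw [hC, hE₀]; field_simp; ring
      _ ≤ ℓ / 4 * (C * E₀ / 2 * (Real.log y / Λ)) := by
          refine mul_le_mul_of_nonneg_left ?_ (by positivity)
          exact mul_le_mul_of_nonneg_left hfrac (by positivity)
  have hstep3 : (1 + c₁) * (u * Real.log y) ≤ ℓ * M / 40 * (u * Real.log y) := by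
    have : 1 + c₁ ≤ ℓ * M / 40 := by
      rw [le_div_iff₀ (by norm_num : (0 : ℝ) < 40)]
      have := (div_le_iff₀ hℓ0).1 hM40
      linarith
    exact mul_le_mul_of_nonneg_right this (by positivity)
  have hulogy1 : 1 ≤ u * Real.log y := by rw [hulogy]; linarith
  have hmain : Real.log x ≤ saddleSum σ₁ y := by
    have hTs := sum_primesLE_log_mul_rpow_le_saddleSum hσ₁0 y
    have hc : c₁ * 1 ≤ c₁ * (u * Real.log y) := mul_le_mul_of_nonneg_left hulogy1 hc₁
    have h0 : u * Real.log y ≤ (1 + c₁) * (u * Real.log y) - c₁ := by linarith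
    linarith
  -- conclusion
  have hα : σ₁ ≤ saddlePoint x y := le_saddlePoint_of_le_saddleSum hx1 hy2 hσ₁0 hmain
  calc (y : ℝ) ^ (1 - saddlePoint x y) ≤ (y : ℝ) ^ (1 - σ₁) :=
        Real.rpow_le_rpow_of_exponent_le hy1 (by linarith)
    _ = C * E₀ := hpow
    _ = C * (u * Real.log (u + 1)) := by rw [hE₀]


/-! ### The lower bound `y^{1-α} ≫ u log(u+1)` -/

/-- **`α(x, y) ≤ 1 + 4/log y`** for `y₀ ≤ y ≤ x`: at `σ = 1 + 4/log y`,
`-φ₁(σ, y) ≤ Σ_p log p · p^{-σ} + 30 ≤ log 4 · (1 + 2 · (log y)/4) + 30 ≤ log y ≤ log x`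
(partial summation, `∫₂^y t^{-σ} dt ≤ 1/(σ - 1)`). [cite: HildebrandTenenbaum1986, Lemma 2 (3.5)] -/
theorem saddlePoint_le_one_add_div_log :
    ∀ (x : ℝ) (y : ℕ), ⌈Real.exp 107⌉₊ ≤ y → (y : ℝ) ≤ x →
      saddlePoint x y ≤ 1 + 4 / Real.log y := by
  intro x y hy hyx
  have hyexp : Real.exp 107 ≤ y := le_trans (Nat.le_ceil _) (by exact_mod_cast hy)
  have hy0 : (0 : ℝ) < y := lt_of_lt_of_le (Real.exp_pos _) hyexp
  have hlogy : 107 ≤ Real.log y := by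
    have := Real.log_le_log (Real.exp_pos _) hyexp
    rwa [Real.log_exp] at this
  have hy8 : (8 : ℝ) ≤ y := by
    have : (107 : ℝ) + 1 ≤ Real.exp 107 := Real.add_one_le_exp _
    linarith
  have hy2 : 2 ≤ y := by exact_mod_cast (show (2 : ℝ) ≤ y by linarith)
  have hy1 : (1 : ℝ) ≤ y := by linarith
  have hx1 : 1 < x := by linarith
  have hlogyx : Real.log y ≤ Real.log x := Real.log_le_log hy0 hyx
  have hlogy0 : 0 < Real.log y := by linarith
  set σ₃ : ℝ := 1 + 4 / Real.log y with hσ₃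
  have hdiv : 4 / Real.log y ≤ 1 := by rw [div_le_iff₀ hlogy0]; linarith
  have hdiv0 : 0 < 4 / Real.log y := by positivity
  have hσ₃1 : 1 < σ₃ := by linarith
  have hσ₃2 : σ₃ ≤ 2 := by linarith
  refine saddlePoint_le_of_saddleSum_le hx1 hy2 (by linarith) ?_
  have hs := saddleSum_le_sum_primesLE_log_mul_rpow_add (σ := σ₃) (y := y) (by linarith) hy2
  have hT := sum_primesLE_log_mul_rpow_le (σ := σ₃) (y := y) (by linarith) hy2
  have hI : ∫ t in (2 : ℝ)..y, t ^ (-σ₃) ≤ Real.log y / 4 := by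
    calc ∫ t in (2 : ℝ)..y, t ^ (-σ₃) ≤ 1 / (σ₃ - 1) := integral_rpow_neg_le_of_one_lt hσ₃1 hy2
      _ = Real.log y / 4 := by rw [hσ₃]; field_simp; ring
  have hI0 := integral_rpow_neg_nonneg σ₃ hy2
  have hypow : (y : ℝ) ^ (1 - σ₃) ≤ 1 := Real.rpow_le_one_of_one_le_of_nonpos hy1 (by linarith)
  have hl4 := log_four_le
  have hl40 : 0 < Real.log 4 := Real.log_pos (by norm_num)
  have h1 : σ₃ * ∫ t in (2 : ℝ)..y, t ^ (-σ₃) ≤ 2 * (Real.log y / 4) :=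
    mul_le_mul hσ₃2 hI hI0 (by norm_num)
  have h2 : Real.log 4 * ((y : ℝ) ^ (1 - σ₃) + σ₃ * ∫ t in (2 : ℝ)..y, t ^ (-σ₃)) ≤
      Real.log 4 * (1 + Real.log y / 2) := mul_le_mul_of_nonneg_left (by linarith) hl40.le
  have h3 : Real.log 4 * (1 + Real.log y / 2) ≤ 1.39 + 0.7 * Real.log y := by nlinarith
  linarith

/-- `exp 10 ≥ 60` and friends: `exp 1 > 2.7`. [folklore] -/
theorem sixty_le_exp_ten : (60 : ℝ) ≤ Real.exp 10 := by
  have h1 : (2.7 : ℝ) ≤ Real.exp 1 := by have := Real.exp_one_gt_d9; linarith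
  have h : (2.7 : ℝ) ^ 10 ≤ Real.exp 1 ^ 10 := pow_le_pow_left₀ (by norm_num) h1 10
  rw [show (10 : ℝ) = ((10 : ℕ) : ℝ) by norm_num, ← Real.exp_one_pow 10]
  calc (60 : ℝ) ≤ (2.7 : ℝ) ^ 10 := by norm_num
    _ ≤ Real.exp 1 ^ 10 := h

/-- **`y^{1 - α(x,y)} ≫ u log(u + 1)`** (`u = log x/log y`) in the range `(log x)^3 ≤ y ≤ x`, `x ≥ x₀`:
the half "`1 - α(x, y) ≥ (log(u log(u+1)) - O(1))/log y`" of Hildebrand–Tenenbaum's approximation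
[HildebrandTenenbaum1986, Lemma 2 (3.5) with Lemma 1; Thm 2 (2.4)] = [Harper2016, §2.1 (2.1)]
(used in the proof of Smooth Numbers Result 3 through `Σ_j 2^{-j(1-α)} ≪ log y/log(u+1)`). Proof:
for `u ≥ e^{10}`, at `σ₂ = 1 - log(u log(u+1)/8)/log y` partial summation gives
`-φ₁(σ₂, y) ≤ log 4 · (y^{1-σ₂} + y^{1-σ₂}/(1-σ₂)) + 30 ≤ log x`, whence `α ≤ σ₂`; for bounded `u`,
`α ≤ 1 + 4/log y` (`saddlePoint_le_one_add_div_log`) gives `y^{1-α} ≥ e^{-4}`.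
(Printed range: `log x < y ≤ x`. TODO(general form).)
[cite: HildebrandTenenbaum1986, Lemma 2 (3.5) and Lemma 3 (3.7)] [cite: Harper2016, §2.1 (2.1)] -/
theorem le_rpow_one_sub_saddlePoint :
    ∃ c x₀ : ℝ, 0 < c ∧ ∀ (x : ℝ) (y : ℕ), x₀ ≤ x → Real.log x ^ 3 ≤ y → (y : ℝ) ≤ x →
      c * (Real.log x / Real.log y * Real.log (Real.log x / Real.log y + 1)) ≤
        (y : ℝ) ^ (1 - saddlePoint x y) := by
  obtain ⟨Y, hY1, hY⟩ := exists_log_le_mul_rpow (κ := 8) (ε := 1 / 15) (by norm_num) (by norm_num)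
  set y₀ : ℕ := ⌈Real.exp 107⌉₊ with hy₀
  refine ⟨Real.exp (-14) / 11, Real.exp (max (max Y 60) y₀), by positivity,
    fun x y hx hlx hyx => ?_⟩
  -- the range
  have hlogx : max (max Y 60) (y₀ : ℝ) ≤ Real.log x := by
    have := Real.log_le_log (Real.exp_pos _) hx
    rwa [Real.log_exp] at this
  have hlogx60 : 60 ≤ Real.log x := le_trans (le_trans (le_max_right _ _) (le_max_left _ _)) hlogx
  have hlogxY : Y ≤ Real.log x := le_trans (le_trans (le_max_left _ _) (le_max_left _ _)) hlogx
  have hlogxy₀ : (y₀ : ℝ) ≤ Real.log x := le_trans (le_max_right _ _) hlogx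
  have hlogx_le_y : Real.log x ≤ y := by
    have : Real.log x ≤ Real.log x ^ 3 := by
      calc Real.log x = Real.log x * 1 * 1 := by ring
        _ ≤ Real.log x * Real.log x * Real.log x := by gcongr <;> linarith
        _ = Real.log x ^ 3 := by ring
    linarith
  have hy8 : 8 ≤ y := by exact_mod_cast (show (8 : ℝ) ≤ y by linarith)
  have hyY : Y ≤ y := by linarith
  have hyy₀ : y₀ ≤ y := by exact_mod_cast (show (y₀ : ℝ) ≤ y by linarith)
  obtain ⟨hx1, hy2, hlogy1, hlogyx, hu1, hlxy, huy, hlogu⟩ := range_aux hy8 hlx hyx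
  have hy0 : (0 : ℝ) < y := by exact_mod_cast (lt_of_lt_of_le (by norm_num) hy8)
  have hy1 : (1 : ℝ) ≤ y := by exact_mod_cast (le_trans (by norm_num) hy8)
  have hlogy0 : 0 < Real.log y := by linarith
  set u : ℝ := Real.log x / Real.log y with hu
  have hulogy : u * Real.log y = Real.log x := by rw [hu]; field_simp
  have hu0 : 0 < u := by linarith
  have hlogu2 : Real.log 2 ≤ Real.log (u + 1) := Real.log_le_log two_pos (by linarith)
  have hlogu0 : 0 < Real.log (u + 1) := lt_of_lt_of_le (Real.log_pos one_lt_two) hlogu2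
  set E₀ : ℝ := u * Real.log (u + 1) with hE₀
  have hE₀0 : 0 < E₀ := by positivity
  have hl4 := log_four_le
  have hl40 : 0 < Real.log 4 := Real.log_pos (by norm_num)
  by_cases hu10 : Real.exp 10 ≤ u
  · -- large `u`: the test point `σ₂ = 1 - log(E₀/8)/log y`
    have hlogu10 : 10 ≤ Real.log u := by
      have := Real.log_le_log (Real.exp_pos _) hu10
      rwa [Real.log_exp] at this
    have hlogu' : Real.log u ≤ Real.log (u + 1) := Real.log_le_log hu0 (by linarith)
    have hloglog : Real.log 8 ≤ Real.log (Real.log (u + 1)) :=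
      Real.log_le_log (by norm_num) (by linarith)
    have hu60 : 60 ≤ u := le_trans sixty_le_exp_ten hu10
    set E₈ : ℝ := E₀ / 8 with hE₈
    have hE₈0 : 0 < E₈ := by positivity
    set Λ₂ : ℝ := Real.log E₈ with hΛ₂
    have hΛ₂eq : Λ₂ = Real.log u + Real.log (Real.log (u + 1)) - Real.log 8 := by
      rw [hΛ₂, hE₈, Real.log_div hE₀0.ne' (by norm_num), hE₀, Real.log_mul hu0.ne' hlogu0.ne']
    have hΛ₂ge : Real.log u ≤ Λ₂ := by rw [hΛ₂eq]; linarith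
    have hΛ₂10 : 10 ≤ Λ₂ := le_trans hlogu10 hΛ₂ge
    have hΛ₂0 : 0 < Λ₂ := by linarith
    -- `log(u+1) ≤ 2 Λ₂`
    have hlogu1le : Real.log (u + 1) ≤ Real.log u + 1 := by
      have h : Real.log (u + 1) ≤ Real.log (2 * u) := Real.log_le_log (by linarith) (by linarith)
      rw [Real.log_mul (by norm_num) hu0.ne'] at h
      have := Real.log_two_lt_d9
      linarith
    have hlogu_le : Real.log (u + 1) ≤ 2 * Λ₂ := by linarith
    -- `E₈ ≤ y^{2/5}`, so `Λ₂ ≤ (2/5) log y`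
    have hE₀le : E₀ ≤ (y : ℝ) ^ (1 / 3 : ℝ) * Real.log y :=
      mul_le_mul huy hlogu hlogu0.le (Real.rpow_nonneg hy0.le _)
    have hE₈le : E₈ ≤ (y : ℝ) ^ (2 / 5 : ℝ) := by
      have h1 := hY y hyY
      rw [hE₈, div_le_iff₀ (by norm_num : (0 : ℝ) < 8)]
      calc E₀ ≤ (y : ℝ) ^ (1 / 3 : ℝ) * Real.log y := hE₀le
        _ ≤ (y : ℝ) ^ (1 / 3 : ℝ) * (8 * (y : ℝ) ^ (1 / 15 : ℝ)) :=
            mul_le_mul_of_nonneg_left h1 (Real.rpow_nonneg hy0.le _)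
        _ = (y : ℝ) ^ (2 / 5 : ℝ) * 8 := by
            rw [show (2 / 5 : ℝ) = 1 / 3 + 1 / 15 by norm_num, Real.rpow_add hy0]; ring
    have hΛ₂le : Λ₂ ≤ 2 / 5 * Real.log y := by
      calc Λ₂ ≤ Real.log ((y : ℝ) ^ (2 / 5 : ℝ)) := Real.log_le_log hE₈0 hE₈le
        _ = 2 / 5 * Real.log y := by rw [Real.log_rpow hy0]
    set σ₂ : ℝ := 1 - Λ₂ / Real.log y with hσ₂
    have h1σ₂ : 1 - σ₂ = Λ₂ / Real.log y := by rw [hσ₂]; ring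
    have hΛdiv : Λ₂ / Real.log y ≤ 2 / 5 := by rw [div_le_iff₀ hlogy0]; linarith
    have hΛdiv0 : 0 < Λ₂ / Real.log y := div_pos hΛ₂0 hlogy0
    have hσ₂35 : 3 / 5 ≤ σ₂ := by linarith
    have hσ₂lt : σ₂ < 1 := by linarith
    have hσ₂0 : 0 < σ₂ := by linarith
    have hpow : (y : ℝ) ^ (1 - σ₂) = E₈ := by
      rw [h1σ₂, Real.rpow_def_of_pos hy0, show Real.log y * (Λ₂ / Real.log y) = Λ₂ by field_simp,
        hΛ₂, Real.exp_log hE₈0]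
    -- `-φ₁(σ₂, y) ≤ log x`
    have hmain : saddleSum σ₂ y ≤ Real.log x := by
      have hs := saddleSum_le_sum_primesLE_log_mul_rpow_add hσ₂35 hy2
      have hT := sum_primesLE_log_mul_rpow_le hσ₂0.le hy2
      have hI0 := integral_rpow_neg_nonneg σ₂ hy2
      have hI : ∫ t in (2 : ℝ)..y, t ^ (-σ₂) ≤ E₈ * (Real.log y / Λ₂) := by
        calc ∫ t in (2 : ℝ)..y, t ^ (-σ₂) ≤ (y : ℝ) ^ (1 - σ₂) / (1 - σ₂) :=
              integral_rpow_neg_le_of_lt_one hσ₂lt hy2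
          _ = E₈ * (Real.log y / Λ₂) := by rw [hpow, h1σ₂]; field_simp
      have h1 : σ₂ * ∫ t in (2 : ℝ)..y, t ^ (-σ₂) ≤ 1 * (E₈ * (Real.log y / Λ₂)) :=
        mul_le_mul hσ₂lt.le hI hI0 (by norm_num)
      -- `E₈ ≤ (2/5) E₈ log y / Λ₂`
      have h2 : E₈ ≤ 2 / 5 * (E₈ * (Real.log y / Λ₂)) := by
        have : 1 ≤ 2 / 5 * (Real.log y / Λ₂) := by
          rw [mul_div_assoc', le_div_iff₀ hΛ₂0]; linarith
        calc E₈ = E₈ * 1 := (mul_one _).symm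
          _ ≤ E₈ * (2 / 5 * (Real.log y / Λ₂)) := mul_le_mul_of_nonneg_left this hE₈0.le
          _ = 2 / 5 * (E₈ * (Real.log y / Λ₂)) := by ring
      -- `E₈ log y/Λ₂ ≤ (u/4) log y`
      have h3 : E₈ * (Real.log y / Λ₂) ≤ u / 4 * Real.log y := by
        have : E₈ / Λ₂ ≤ u / 4 := by
          rw [div_le_iff₀ hΛ₂0, hE₈, hE₀]
          calc u * Real.log (u + 1) / 8 ≤ u * (2 * Λ₂) / 8 := by
                gcongr
            _ = u / 4 * Λ₂ := by ring
        calc E₈ * (Real.log y / Λ₂) = E₈ / Λ₂ * Real.log y := by ring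
          _ ≤ u / 4 * Real.log y := mul_le_mul_of_nonneg_right this hlogy0.le
      have h4 : Real.log 4 * ((y : ℝ) ^ (1 - σ₂) + σ₂ * ∫ t in (2 : ℝ)..y, t ^ (-σ₂)) ≤
          2 * (E₈ * (Real.log y / Λ₂)) := by
        rw [hpow]
        have hX0 : 0 ≤ E₈ * (Real.log y / Λ₂) := by positivity
        have h71 : Real.log 4 * (7 / 5) ≤ 2 := by linarith
        calc Real.log 4 * (E₈ + σ₂ * ∫ t in (2 : ℝ)..y, t ^ (-σ₂))
            ≤ Real.log 4 * (7 / 5 * (E₈ * (Real.log y / Λ₂))) :=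
              mul_le_mul_of_nonneg_left (by linarith) hl40.le
          _ = Real.log 4 * (7 / 5) * (E₈ * (Real.log y / Λ₂)) := by ring
          _ ≤ 2 * (E₈ * (Real.log y / Λ₂)) := mul_le_mul_of_nonneg_right h71 hX0
      have h5 : (30 : ℝ) ≤ u / 2 * Real.log y := by
        rw [show u / 2 * Real.log y = u * Real.log y / 2 by ring, hulogy]; linarith
      calc saddleSum σ₂ y ≤ ∑ p ∈ Nat.primesLE y, Real.log p * (p : ℝ) ^ (-σ₂) + 30 := hs
        _ ≤ 2 * (E₈ * (Real.log y / Λ₂)) + 30 := by linarith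
        _ ≤ 2 * (u / 4 * Real.log y) + u / 2 * Real.log y := add_le_add (by linarith) h5
        _ = u * Real.log y := by ring
        _ = Real.log x := hulogy
    have hα : saddlePoint x y ≤ σ₂ := saddlePoint_le_of_saddleSum_le hx1 hy2 hσ₂0 hmain
    calc Real.exp (-14) / 11 * (u * Real.log (u + 1)) ≤ 1 / 8 * E₀ := by
          rw [← hE₀]
          refine mul_le_mul_of_nonneg_right ?_ hE₀0.le
          have : Real.exp (-14) ≤ 1 := Real.exp_le_one_iff.2 (by norm_num)
          rw [div_le_iff₀ (by norm_num : (0 : ℝ) < 11)]; linarith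
      _ = E₈ := by rw [hE₈]; ring
      _ = (y : ℝ) ^ (1 - σ₂) := hpow.symm
      _ ≤ (y : ℝ) ^ (1 - saddlePoint x y) := Real.rpow_le_rpow_of_exponent_le hy1 (by linarith)
  · -- bounded `u`: `α ≤ 1 + 4/log y`, so `y^{1-α} ≥ e^{-4}`
    push Not at hu10
    have hα : saddlePoint x y ≤ 1 + 4 / Real.log y := saddlePoint_le_one_add_div_log x y hyy₀ hyx
    have hpow : (y : ℝ) ^ (-(4 / Real.log y)) = Real.exp (-4) := by
      rw [Real.rpow_def_of_pos hy0, show Real.log y * -(4 / Real.log y) = -4 by field_simp]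
    -- `E₀ ≤ 11 e^{10}`
    have hexp1 : Real.exp 10 + 1 ≤ Real.exp 11 := by
      have h1 : Real.exp 11 = Real.exp 1 * Real.exp 10 := by rw [← Real.exp_add]; norm_num
      have h2 : (2 : ℝ) ≤ Real.exp 1 := by have := Real.exp_one_gt_d9; linarith
      have h3 : (1 : ℝ) ≤ Real.exp 10 := Real.one_le_exp (by norm_num)
      nlinarith [Real.exp_pos 10]
    have hlogu11 : Real.log (u + 1) ≤ 11 := by
      calc Real.log (u + 1) ≤ Real.log (Real.exp 11) :=
            Real.log_le_log (by linarith) (by linarith)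
        _ = 11 := Real.log_exp 11
    have hE₀le : E₀ ≤ Real.exp 10 * 11 := mul_le_mul hu10.le hlogu11 hlogu0.le (Real.exp_pos _).le
    calc Real.exp (-14) / 11 * (u * Real.log (u + 1)) ≤ Real.exp (-14) / 11 * (Real.exp 10 * 11) :=
          mul_le_mul_of_nonneg_left hE₀le (by positivity)
      _ = Real.exp (-4) := by
          rw [show (-4 : ℝ) = -14 + 10 by norm_num, Real.exp_add]; field_simp
      _ = (y : ℝ) ^ (-(4 / Real.log y)) := hpow.symm
      _ ≤ (y : ℝ) ^ (1 - saddlePoint x y) := Real.rpow_le_rpow_of_exponent_le hy1 (by linarith)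

/-! ### The approximation `(1 - α) log y = log(u log(u+1)) + O(1)` -/

/-- **Hildebrand–Tenenbaum's approximation of the saddle point** in the range `(log x)^3 ≤ y ≤ x`
(`x ≥ x₀`): `|(1 - α(x, y)) log y - log(u log(u + 1))| ≤ C` with `u = log x/log y`, i.e.
`α(x, y) = 1 - (log(u log(u+1)) + O(1))/log y` — [HildebrandTenenbaum1986, Lemma 2 (3.5):
"`(1 - α(x,y)) log y = ξ(u) + O(1/u + …)` (`y > log x`)", with Lemma 1: "`ξ(u) = log(u log u) +
O(log log u/log u)`"; Thm 2 (2.4)], quoted as (2.1) in [Harper2016, §2.1]: "when `log x < y ≤ x` one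
has `α(x,y) = 1 - log(u log(u+1))/log y + O(1/log y)`". Here with an unspecified absolute `O(1)` and
in the polylogarithmic-and-above range `y ≥ (log x)^3` (which contains Harper's `logᴷ x ≤ y ≤ x`,
`K ≥ 3`); Chebyshev's bounds for `θ` are the only prime number theory used. TODO(general form):
the printed range `log x < y ≤ x` and error `O(1/u)`-type refinements.
[cite: HildebrandTenenbaum1986, Lemma 2 (3.5) and Lemma 1] [cite: Harper2016, §2.1 (2.1)] -/
theorem abs_one_sub_saddlePoint_mul_log_sub_log_le :
    ∃ C x₀ : ℝ, ∀ (x : ℝ) (y : ℕ), x₀ ≤ x → Real.log x ^ 3 ≤ y → (y : ℝ) ≤ x →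
      |(1 - saddlePoint x y) * Real.log y -
          Real.log (Real.log x / Real.log y * Real.log (Real.log x / Real.log y + 1))| ≤ C := by
  obtain ⟨C, x₁, hC, hA⟩ := rpow_one_sub_saddlePoint_le
  obtain ⟨c, x₂, hc, hB⟩ := le_rpow_one_sub_saddlePoint
  refine ⟨|Real.log C| + |Real.log c|, max (max x₁ x₂) (Real.exp 8), fun x y hx hlx hyx => ?_⟩
  have hx₁ : x₁ ≤ x := le_trans (le_trans (le_max_left _ _) (le_max_left _ _)) hx
  have hx₂ : x₂ ≤ x := le_trans (le_trans (le_max_right _ _) (le_max_left _ _)) hx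
  have hx8 : Real.exp 8 ≤ x := le_trans (le_max_right _ _) hx
  have hlogx8 : 8 ≤ Real.log x := by
    have := Real.log_le_log (Real.exp_pos _) hx8
    rwa [Real.log_exp] at this
  have hlogx_le_y : Real.log x ≤ y := by
    have : Real.log x ≤ Real.log x ^ 3 := by
      calc Real.log x = Real.log x * 1 * 1 := by ring
        _ ≤ Real.log x * Real.log x * Real.log x := by gcongr <;> linarith
        _ = Real.log x ^ 3 := by ring
    linarith
  have hy8 : 8 ≤ y := by exact_mod_cast (show (8 : ℝ) ≤ y by linarith)
  obtain ⟨hx1, hy2, hlogy1, hlogyx, hu1, -, -, -⟩ := range_aux hy8 hlx hyx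
  have hy0 : (0 : ℝ) < y := by exact_mod_cast (lt_of_lt_of_le (by norm_num) hy8)
  set u : ℝ := Real.log x / Real.log y with hu
  have hu0 : 0 < u := by linarith
  have hlogu0 : 0 < Real.log (u + 1) := Real.log_pos (by linarith)
  set E₀ : ℝ := u * Real.log (u + 1) with hE₀
  have hE₀0 : 0 < E₀ := by positivity
  have h1 := hA x y hx₁ hlx hyx
  have h2 := hB x y hx₂ hlx hyx
  have hpow0 : 0 < (y : ℝ) ^ (1 - saddlePoint x y) := Real.rpow_pos_of_pos hy0 _
  have hlogpow : Real.log ((y : ℝ) ^ (1 - saddlePoint x y)) =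
      (1 - saddlePoint x y) * Real.log y := by
    rw [Real.log_rpow hy0]
  have hup : (1 - saddlePoint x y) * Real.log y ≤ Real.log C + Real.log E₀ := by
    rw [← hlogpow, ← Real.log_mul hC.ne' hE₀0.ne']
    exact Real.log_le_log hpow0 h1
  have hlow : Real.log c + Real.log E₀ ≤ (1 - saddlePoint x y) * Real.log y := by
    rw [← hlogpow, ← Real.log_mul hc.ne' hE₀0.ne']
    exact Real.log_le_log (by positivity) h2
  rw [abs_le]
  constructor
  · have := neg_abs_le (Real.log c); linarith [abs_nonneg (Real.log C)]
  · have := le_abs_self (Real.log C); linarith [abs_nonneg (Real.log c)]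

/-- **`(1 - α) log y ≥ log(u + 1) - O(1)`** in the range `(log x)^3 ≤ y ≤ x` (`x ≥ x₀`): the form of the
lower half of (2.1) behind "`Σ_{0 ≤ j ≤ log y/log 2} 2^{j(α-1)} ≪ log y/log(u+1)`" in the proof of
Smooth Numbers Result 3 of [Harper2016, §2.1].
[cite: Harper2016, §2.1 (2.1) and proof of Smooth Numbers Result 3] -/
theorem log_add_one_sub_le_one_sub_saddlePoint_mul_log :
    ∃ C x₀ : ℝ, ∀ (x : ℝ) (y : ℕ), x₀ ≤ x → Real.log x ^ 3 ≤ y → (y : ℝ) ≤ x →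
      Real.log (Real.log x / Real.log y + 1) - C ≤ (1 - saddlePoint x y) * Real.log y := by
  obtain ⟨c, x₂, hc, hB⟩ := le_rpow_one_sub_saddlePoint
  refine ⟨Real.log 2 - Real.log (Real.log 2) - Real.log c, max x₂ (Real.exp 8),
    fun x y hx hlx hyx => ?_⟩
  have hx₂ : x₂ ≤ x := le_trans (le_max_left _ _) hx
  have hx8 : Real.exp 8 ≤ x := le_trans (le_max_right _ _) hx
  have hlogx8 : 8 ≤ Real.log x := by
    have := Real.log_le_log (Real.exp_pos _) hx8
    rwa [Real.log_exp] at this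
  have hlogx_le_y : Real.log x ≤ y := by
    have : Real.log x ≤ Real.log x ^ 3 := by
      calc Real.log x = Real.log x * 1 * 1 := by ring
        _ ≤ Real.log x * Real.log x * Real.log x := by gcongr <;> linarith
        _ = Real.log x ^ 3 := by ring
    linarith
  have hy8 : 8 ≤ y := by exact_mod_cast (show (8 : ℝ) ≤ y by linarith)
  obtain ⟨hx1, hy2, hlogy1, hlogyx, hu1, -, -, -⟩ := range_aux hy8 hlx hyx
  have hy0 : (0 : ℝ) < y := by exact_mod_cast (lt_of_lt_of_le (by norm_num) hy8)
  set u : ℝ := Real.log x / Real.log y with hu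
  have hu0 : 0 < u := by linarith
  have hlogu2 : Real.log 2 ≤ Real.log (u + 1) := Real.log_le_log two_pos (by linarith)
  have hlogu0 : 0 < Real.log (u + 1) := lt_of_lt_of_le (Real.log_pos one_lt_two) hlogu2
  have h2 := hB x y hx₂ hlx hyx
  have hlogpow : Real.log ((y : ℝ) ^ (1 - saddlePoint x y)) =
      (1 - saddlePoint x y) * Real.log y := by
    rw [Real.log_rpow hy0]
  have hlow : Real.log c + (Real.log u + Real.log (Real.log (u + 1))) ≤
      (1 - saddlePoint x y) * Real.log y := by
    rw [← hlogpow, ← Real.log_mul hu0.ne' hlogu0.ne', ← Real.log_mul hc.ne' (by positivity)]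
    exact Real.log_le_log (by positivity) h2
  -- `log u ≥ log(u+1) - log 2`, `log log(u+1) ≥ log log 2`
  have hlogu : Real.log (u + 1) - Real.log 2 ≤ Real.log u := by
    have h : Real.log (u + 1) ≤ Real.log (2 * u) := Real.log_le_log (by linarith) (by linarith)
    rw [Real.log_mul (by norm_num) hu0.ne'] at h
    linarith
  have hll : Real.log (Real.log 2) ≤ Real.log (Real.log (u + 1)) :=
    Real.log_le_log (Real.log_pos one_lt_two) hlogu2
  linarith

end Literature.NumberTheory.Sieve

end
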